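import Summits.BirchSwinnertonDyer.BirchSwinnertonDyer.Theses.CycTangentCM
import Literature.NumberTheory.EllipticCurves.DeShalit1987.KatzMeasureMonomialLinesPAdic
import Literature.NumberTheory.EllipticCurves.IntSeriesFwdDiffCertificate
import HarnessLib

/-!
# Crux `CycTangentCM.CycTangentBound` (stmt-BirchSwinnertonDyer-22628), N-line assembly (A4): the KERNEL
# FORM of the negative road — a forward-difference certificate on ONE line of the two-variable frame
# together with the cyclotomic non-unit segment REFUTES `CycTangentBound`
# (`--supports 22628`; nothing is closed; the crux is NOT claimed false here; BSD is not proved)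

Seat `prover-bsd-line-ctcm-p3` (D-0145 line `route-BirchSwinnertonDyer-CycTangentCM`, prover 3/3), the
assembly of this seat's N-line pieces for the lead's falsifier road
(`Cruxes/CycTangentBound/Lines/tangent_cone_parity_falsifier.md`):

* `isUnit_coeff_of_fwdDiffCertificate` — **the certificate, iterated.**  For `F ∈ 𝒪_{ℂ_p}⟦T⟧`, nodes
  `u^t − 1` (`u ≠ 1`, `‖u − 1‖ < 1`), a drift `η` (`‖η − 1‖ ≤ ‖u − 1‖`), `k < p`, and values
  `v_t = F(u^t − 1)` (`t ≤ k`): if the normalised forward differences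
  `D_j = Σ_{t ≤ j} (−1)^{j−t} C(j,t) η^t v_t` satisfy `‖D_j‖ < ‖u − 1‖^j` for `j < k` and
  `‖D_k‖ = ‖u − 1‖^k`, then `[T^j]F` is a NON-unit for `j < k` and `[T^k]F` IS a unit — induction on `j`
  with `IntSeries.not_isUnit_coeff_iff_norm_fwdDiff_values_lt` / `isUnit_coeff_iff_norm_fwdDiff_values_eq`
  (p586527).  So `λ̄(F) = k` is decided by `k + 1` values and NO power-series coefficient.
* `not_cycTangentBound_of_fwdDiffCertificate` — **THE ASSEMBLY (kernel form).**  In the frame of the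
  crux (its binders verbatim, `G` with `IsKatzMeasure₂ … ψ⁻¹ … G`): a line direction `(c₁, c₂) ∈ ℤ_p²`,
  node data `(u, η, k)` as above with values `v_t` OF THE BRANCH `monomialLine c₁ c₂ G` at `u^t − 1`
  (`t ≤ k`) carrying the certificate, and the cyclotomic segment `[T^m]G(0,T) ∈ 𝔪` for `m ≤ k + 1`,
  together give `¬ CycTangentBound` — `isUnit_coeff_of_fwdDiffCertificate`, the lift of the line's unit
  coefficient to a unit `[T₁^iT₂^j]G` with `i + j ≤ k` (`exists_isUnit_coeff_coeff_of_isUnit_coeff_monomialLine`),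
  and CTB's own conclusion (the line-gap argument of `not_cycTangentBound_of_lineGap`, p585721, inlined).
  The values `v_t` are supplied ON THE SPLIT-PRIME LINE by
  `CycTangentCMCycTangentBoundSplitPrimePowerLine.exists_splitPrimeLine_powerLine` (direction
  `(κγ₁, κγ₂)`, nodes `u^n − 1`, `u ≠ 1`, `‖u − 1‖ < ‖p‖`, values
  `ι⁻¹(interpolationValue … (ψ⁻¹Ψ^{−Mn}) (1 + wMn) 0 …)·Ω_p^{1+wMn}`); the cyclotomic segment by the lead's
  `forall_not_isUnit_coeff_constantCoeff_of_sec12` (p586224).  What remains OUTSIDE the kernel is the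
  numerical evaluation of the `k + 1` norms `‖D_j‖` (algebraic Hecke `L`-values; a `kit` job) — and the
  existence of the frame `G` itself.  Nothing here asserts that such a certificate exists.

Theorems only; nothing is closed; crux 22628 stays OPEN; BSD is not proved by any of this.
References: [deShalit1987] II.4.16–4.17; [Washington1997] §5.2, §13.1; [Gouvea1993PadicNumbers] §5.6.
-/

set_option linter.dupNamespace false
set_option autoImplicit false

noncomputable section

open Finset
open Literature.NumberTheory.GaloisRepresentations
open Literature.NumberTheory.EllipticCurves
open Literature.NumberTheory.EllipticCurves.GreenbergVatsal2000

namespace Summit.BirchSwinnertonDyer.BirchSwinnertonDyer.Theorems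

variable {p : ℕ} [Fact p.Prime]

/-! ### §1. The forward-difference certificate, iterated: `λ̄(F) = k` from `k + 1` values -/

/-- **`λ̄(F) = k` certified by forward differences of values.**  With nodes `u^t − 1` (`u ≠ 1`,
`‖u − 1‖ < 1`), drift `η` (`‖η − 1‖ ≤ ‖u − 1‖`), `k < p`, values `F(u^t − 1) = v_t` for `t ≤ k`, and the
normalised forward differences `D_j = Σ_{t≤j} (−1)^{j−t}C(j,t) η^t v_t`: if `‖D_j‖ < ‖u − 1‖^j` for all
`j < k` then `[T^j]F ∈ 𝔪` for all `j < k` (induction on `j`, `not_isUnit_coeff_iff_norm_fwdDiff_values_lt`). -/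
theorem forall_not_isUnit_coeff_of_fwdDiffCertificate (F : PowerSeries (PadicComplexInt p)) {u η : ℂ_[p]}
    (hu0 : u - 1 ≠ 0) (hu1 : ‖u - 1‖ < 1) (hη : ‖η - 1‖ ≤ ‖u - 1‖) {k : ℕ} (hk : k ≤ p)
    {val : ℕ → ℂ_[p]} (hval : ∀ t, t < k → IntSeries.HasValueAt F (u ^ t - 1) (val t))
    (hlow : ∀ j, j < k →
      ‖∑ t ∈ range (j + 1), IntSeries.fwdDiffWeight p j t * (η ^ t * val t)‖ < ‖u - 1‖ ^ j) :
    ∀ j, j < k → ¬ IsUnit (PowerSeries.coeff j F) := by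
  intro j
  induction j using Nat.strong_induction_on with
  | _ j ih =>
    intro hj
    have hjp : j < p := lt_of_lt_of_le hj hk
    have hlow' : ∀ i, i < j → ¬ IsUnit (PowerSeries.coeff i F) := fun i hi ↦ ih i hi (hi.trans hj)
    have hval' : ∀ t, t ≤ j → IntSeries.HasValueAt F (u ^ t - 1) (val t) :=
      fun t ht ↦ hval t (lt_of_le_of_lt ht hj)
    exact (IntSeries.not_isUnit_coeff_iff_norm_fwdDiff_values_lt F hu0 hu1 hη hjp hlow' hval').mpr
      (hlow j hj)

/-- **`[T^k]F` is a unit, certified by forward differences of values**: under the hypotheses of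
`forall_not_isUnit_coeff_of_fwdDiffCertificate` for `j < k` (`k < p`) and the EXACT norm
`‖D_k‖ = ‖u − 1‖^k` at `k`, the coefficient `[T^k]F` is a unit of `𝒪_{ℂ_p}` — so `λ̄(F) = k`
(`isUnit_coeff_iff_norm_fwdDiff_values_eq`). -/
theorem isUnit_coeff_of_fwdDiffCertificate (F : PowerSeries (PadicComplexInt p)) {u η : ℂ_[p]}
    (hu0 : u - 1 ≠ 0) (hu1 : ‖u - 1‖ < 1) (hη : ‖η - 1‖ ≤ ‖u - 1‖) {k : ℕ} (hk : k < p)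
    {val : ℕ → ℂ_[p]} (hval : ∀ t, t ≤ k → IntSeries.HasValueAt F (u ^ t - 1) (val t))
    (hlow : ∀ j, j < k →
      ‖∑ t ∈ range (j + 1), IntSeries.fwdDiffWeight p j t * (η ^ t * val t)‖ < ‖u - 1‖ ^ j)
    (htop : ‖∑ t ∈ range (k + 1), IntSeries.fwdDiffWeight p k t * (η ^ t * val t)‖ = ‖u - 1‖ ^ k) :
    IsUnit (PowerSeries.coeff k F) := by
  have hlow' : ∀ j, j < k → ¬ IsUnit (PowerSeries.coeff j F) :=
    forall_not_isUnit_coeff_of_fwdDiffCertificate F hu0 hu1 hη hk.le (fun t ht ↦ hval t ht.le) hlow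
  exact (IntSeries.isUnit_coeff_iff_norm_fwdDiff_values_eq F hu0 hu1 hη hk hlow' hval).mpr htop

/-! ### §2. The assembly: a certificate on one line + the cyclotomic segment refute `CycTangentBound` -/

/-- **N-LINE ASSEMBLY (kernel form): a forward-difference certificate on ONE line of the crux's frame,
together with the cyclotomic non-unit segment up to `k + 1`, REFUTES `CycTangentBound`.**  In the frame
of the crux (binders verbatim; `G` the two-variable branch, `IsKatzMeasure₂ … ψ⁻¹ … G`): given a line
direction `(c₁, c₂)`, node data `u ≠ 1`, `‖u − 1‖ < 1`, a drift `η` with `‖η − 1‖ ≤ ‖u − 1‖`, `k < p`,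
values `v_t` of the branch `monomialLine c₁ c₂ G` at `u^t − 1` (`t ≤ k`) whose normalised forward
differences satisfy `‖D_j‖ < ‖u − 1‖^j` (`j < k`) and `‖D_k‖ = ‖u − 1‖^k`, and `[T^m]G(0,T) ∈ 𝔪` for all
`m ≤ k + 1`: then `¬ CycTangentBound` — the line has `λ̄ = k` (`isUnit_coeff_of_fwdDiffCertificate`) while
CTB forces `λ̄_cyc ≤ k + 1` (the line gap of p585721, inlined).  Nothing asserts that such data exist. -/
theorem not_cycTangentBound_of_fwdDiffCertificate :
    ∀ (A : WeierstrassCurve ℚ) [A.IsElliptic] [A.IsGloballyMinimal] (p : ℕ) [Fact p.Prime], 5 ≤ p →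
      A.j ∈ Literature.NumberTheory.EllipticCurves.maximalCMJInvariants → A.HasGoodReductionAtPrime
      p → ¬ (p : ℤ) ∣ A.frobeniusTrace p → A.HasIrreducibleModPGaloisRep p → ∀ (K : Type) [Field K]
      [NumberField K], Literature.NumberTheory.EllipticCurves.IsCMFieldOfJ K A.j → ∀ (ψ :
      Literature.NumberTheory.GaloisRepresentations.HeckeCharacter K), ψ.HasInfinityType (fun _ ↦
      1) (fun _ ↦ 0) → (∀ s : ℂ, 3 / 2 < s.re →
      Literature.NumberTheory.GaloisRepresentations.heckeLFunction ψ s = A.LSeries s) → ∀ (ι :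
      PadicAlgCl p ≃+* ℂ) (v vbar : IsDedekindDomain.HeightOneSpectrum (NumberField.RingOfIntegers
      K)), ((p : ℕ) : NumberField.RingOfIntegers K) ∈ v.asIdeal → ((p : ℕ) :
      NumberField.RingOfIntegers K) ∈ vbar.asIdeal → vbar ≠ v → (∀ (w : NumberField.InfinitePlace
      K) (k : NumberField.RingOfIntegers K), k ∈ v.asIdeal ↔ ‖ι.symm (w.embedding (k : K))‖ < 1) →
      ∀ (S : Finset (IsDedekindDomain.HeightOneSpectrum (NumberField.RingOfIntegers K))), v ∉ S →
      vbar ∉ S → (∀ w ∈ S, ¬ ψ.IsUnramifiedAt w) → (∀ w : IsDedekindDomain.HeightOneSpectrum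
      (NumberField.RingOfIntegers K), w ∉ S → ψ.IsUnramifiedAt w) → ∀ (κ₁ κ₂ :
      Literature.NumberTheory.EllipticCurves.ZpExtension K p) (γ₁ γ₂ : Field.absoluteGaloisGroup
      K), Literature.NumberTheory.EllipticCurves.ZpExtension.IsTopGeneratorPair κ₁ κ₂ γ₁ γ₂ →
      κ₂.IsCyclotomic → (∃ ζ : (PadicInt p)ˣ, IsOfFinOrder ζ ∧
      ((Literature.NumberTheory.GaloisRepresentations.GaloisRep.cyclotomicCharacter K p γ₂ * ζ :
      (PadicInt p)ˣ) : PadicInt p) = (Literature.NumberTheory.EllipticCurves.cyclotomicGenerator p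
      : PadicInt p)) → ∀ (Ω δ : ℂ) (Ωp : PadicComplex p), Ω ≠ 0 → Ωp ≠ 0 → (δ ^ 2 =
      (NumberField.discr K : ℂ) ∨ δ ^ 2 = -(NumberField.discr K : ℂ)) → ∀ (G : PowerSeries
      (PowerSeries (PadicComplexInt p))), Literature.NumberTheory.EllipticCurves.IsKatzMeasure₂ ι v
      vbar S κ₁ κ₂ γ₁ γ₂ ψ⁻¹ Ω δ Ωp G →
      ∀ (c₁ c₂ : ℤ_[p]) (u η : ℂ_[p]) (k : ℕ) (val : ℕ → ℂ_[p]), u - 1 ≠ 0 → ‖u - 1‖ < 1 →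
      ‖η - 1‖ ≤ ‖u - 1‖ → k < p →
      (∀ t, t ≤ k → IntSeries.HasValueAt (IntSeries.monomialLine c₁ c₂ G) (u ^ t - 1) (val t)) →
      (∀ j, j < k →
        ‖∑ t ∈ range (j + 1), IntSeries.fwdDiffWeight p j t * (η ^ t * val t)‖ < ‖u - 1‖ ^ j) →
      ‖∑ t ∈ range (k + 1), IntSeries.fwdDiffWeight p k t * (η ^ t * val t)‖ = ‖u - 1‖ ^ k →
      (∀ m : ℕ, m ≤ k + 1 → ¬ IsUnit (PowerSeries.coeff m (PowerSeries.constantCoeff G))) →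
      ¬ Summit.BirchSwinnertonDyer.BirchSwinnertonDyer.Theses.CycTangentCM.CycTangentBound := by
  intro A _ _ p _ hp hj hgood hord hirr K _ _ hK ψ hψ hL ι v vbar hv hvbar hne hι S hvS hvbarS hSram hSunr κ₁ κ₂
    γ₁ γ₂ hpair hcyc hγ₂ Ω δ Ωp hΩ hΩp hδ G hG c₁ c₂ u η k val hu0 hu1 hη hk hval hlow htop hgap hC
  -- the line has a unit coefficient in degree `k` …
  have hunit : IsUnit (PowerSeries.coeff k (IntSeries.monomialLine c₁ c₂ G)) :=
    isUnit_coeff_of_fwdDiffCertificate _ hu0 hu1 hη hk hval hlow htop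
  -- … coming from a unit `[T₁^i T₂^j]G` with `i + j ≤ k` …
  obtain ⟨i, j, hij, hu⟩ := IntSeries.exists_isUnit_coeff_coeff_of_isUnit_coeff_monomialLine hunit
  -- … which `CycTangentBound` turns into a unit coefficient of `G(0,T)` in degree `≤ i + j + 1 ≤ k + 1`
  obtain ⟨m, hm, hmu⟩ := hC A p hp hj hgood hord hirr K hK ψ hψ hL ι v vbar hv hvbar hne hι S hvS hvbarS hSram
    hSunr κ₁ κ₂ γ₁ γ₂ hpair hcyc hγ₂ Ω δ Ωp hΩ hΩp hδ G hG i j hu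
  exact hgap m (by omega) hmu

end Summit.BirchSwinnertonDyer.BirchSwinnertonDyer.Theorems
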